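import Mathlib.MeasureTheory.Function.ConditionalExpectation.Real
import Mathlib.Probability.Moments.Covariance
import HarnessLib

/-!
# Covariance bookkeeping for the decay transfer (`YM3IR/CovarianceLemmas.lean`; cell `pub-ymgap`,
track Y4, ym3ir-theory-2)

HONEST FRAMING. Three elementary, fully PROVED probability lemmas — the generic (model-free) part
of the support statement `DecayTransfer` of `YM3IR/Statement.lean`:

* `covariance_eq_integral_condCov_add` — the **law of total covariance**
  `cov(f, g) = E[ E[fg|m] − E[f|m] E[g|m] ] + cov(E[f|m], E[g|m])` for bounded measurable `f, g`
  and a sub-σ-algebra `m`;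
* `condExp_mem_Icc_ae` — `a ≤ g ≤ b` a.e. implies `a ≤ E[g|m] ≤ b` a.e.;
* `abs_covariance_le_of_abs_le` — if `|D| ≤ η` a.e. and `a ≤ Y ≤ b` a.e. then
  `|cov(D, Y)| ≤ 2 η (b − a)` (the cross-term estimate: a uniformly small factor against a factor of
  controlled OSCILLATION, not of controlled size).

Nothing here is specific to gauge theories; no claim beyond these statements. No axiom, no
`sorry`. [folklore]
-/

noncomputable section

open MeasureTheory ProbabilityTheory Filter

namespace Summit.Ventures.YMGap.YM3IR

variable {Ω : Type*} {m m0 : MeasurableSpace Ω} {μ : Measure[m0] Ω}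

/-- A real function bounded a.e. is in `L²` of a finite measure (bookkeeping). [folklore] -/
theorem memLp_two_of_ae_bound [IsFiniteMeasure μ] {f : Ω → ℝ} (hf : AEStronglyMeasurable f μ)
    {C : ℝ} (hC : ∀ᵐ ω ∂μ, |f ω| ≤ C) : MemLp f 2 μ :=
  MemLp.of_bound hf C (hC.mono fun ω h => by simpa [Real.norm_eq_abs] using h)

/-- `a ≤ g ≤ b` a.e. implies `a ≤ E[g | m] ≤ b` a.e. (finite measure, `m ≤ m0`). [folklore] -/
theorem condExp_mem_Icc_ae [IsFiniteMeasure μ] (hm : m ≤ m0) {g : Ω → ℝ} (hg : Integrable g μ)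
    {a b : ℝ} (hab : ∀ᵐ ω ∂μ, a ≤ g ω ∧ g ω ≤ b) :
    ∀ᵐ ω ∂μ, a ≤ (μ[g|m]) ω ∧ (μ[g|m]) ω ≤ b := by
  have h1 : (μ[fun _ => a|m]) ≤ᵐ[μ] μ[g|m] :=
    condExp_mono (integrable_const a) hg (hab.mono fun ω h => h.1)
  have h2 : μ[g|m] ≤ᵐ[μ] μ[fun _ => b|m] :=
    condExp_mono hg (integrable_const b) (hab.mono fun ω h => h.2)
  rw [condExp_const hm a] at h1
  rw [condExp_const hm b] at h2
  filter_upwards [h1, h2] with ω hω1 hω2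
  exact ⟨hω1, hω2⟩

/-- On a probability space, the mean of a function with values a.e. in `[a, b]` lies in `[a, b]`.
[folklore] -/
theorem integral_mem_Icc_of_ae [IsProbabilityMeasure μ] {g : Ω → ℝ} (hg : Integrable g μ)
    {a b : ℝ} (hab : ∀ᵐ ω ∂μ, a ≤ g ω ∧ g ω ≤ b) :
    a ≤ ∫ ω, g ω ∂μ ∧ ∫ ω, g ω ∂μ ≤ b := by
  constructor
  · have := integral_mono_ae (integrable_const a) hg (hab.mono fun ω h => h.1)
    simpa using this
  · have := integral_mono_ae hg (integrable_const b) (hab.mono fun ω h => h.2)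
    simpa using this

/-- **Cross-term estimate.** If `|D| ≤ η` a.e. and `a ≤ Y ≤ b` a.e. (both a.e.-strongly measurable,
probability measure) then `|cov(D, Y)| ≤ 2 η (b − a)`: a uniformly small factor against a factor
whose OSCILLATION (not size) is controlled. [folklore] -/
theorem abs_covariance_le_of_abs_le [IsProbabilityMeasure μ] {D Y : Ω → ℝ}
    (hD : AEStronglyMeasurable D μ) (hY : AEStronglyMeasurable Y μ) {η a b : ℝ}
    (hη : ∀ᵐ ω ∂μ, |D ω| ≤ η) (hab : ∀ᵐ ω ∂μ, a ≤ Y ω ∧ Y ω ≤ b) :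
    |cov[D, Y; μ]| ≤ 2 * η * (b - a) := by
  have hDi : Integrable D μ := (memLp_two_of_ae_bound hD hη).integrable one_le_two
  have hYb : ∀ᵐ ω ∂μ, |Y ω| ≤ max |a| |b| :=
    hab.mono fun ω h => abs_le_max_abs_abs h.1 h.2
  have hYi : Integrable Y μ := (memLp_two_of_ae_bound hY hYb).integrable one_le_two
  -- the two means
  have hmD : |∫ ω, D ω ∂μ| ≤ η := by
    calc |∫ ω, D ω ∂μ| ≤ ∫ ω, |D ω| ∂μ := abs_integral_le_integral_abs
      _ ≤ ∫ _, η ∂μ := integral_mono_ae hDi.abs (integrable_const η) hη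
      _ = η := by simp
  have hmY := integral_mem_Icc_of_ae hYi hab
  -- pointwise bound of the integrand of the covariance
  have hpt : ∀ᵐ ω ∂μ, |(D ω - ∫ x, D x ∂μ) * (Y ω - ∫ x, Y x ∂μ)| ≤ 2 * η * (b - a) := by
    filter_upwards [hη, hab] with ω hωD hωY
    rw [abs_mul]
    have h1 : |D ω - ∫ x, D x ∂μ| ≤ 2 * η := by
      calc |D ω - ∫ x, D x ∂μ| ≤ |D ω| + |∫ x, D x ∂μ| := abs_sub _ _
        _ ≤ η + η := add_le_add hωD hmD
        _ = 2 * η := by ring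
    have h2 : |Y ω - ∫ x, Y x ∂μ| ≤ b - a := by
      rw [abs_le]; constructor <;> linarith [hωY.1, hωY.2, hmY.1, hmY.2]
    have hη0 : 0 ≤ 2 * η := by linarith [(abs_nonneg (D ω)).trans hωD]
    exact mul_le_mul h1 h2 (abs_nonneg _) hη0
  calc |cov[D, Y; μ]| = |∫ ω, (D ω - ∫ x, D x ∂μ) * (Y ω - ∫ x, Y x ∂μ) ∂μ| := rfl
    _ ≤ ∫ ω, |(D ω - ∫ x, D x ∂μ) * (Y ω - ∫ x, Y x ∂μ)| ∂μ := abs_integral_le_integral_abs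
    _ ≤ ∫ _, 2 * η * (b - a) ∂μ := by
        refine integral_mono_of_nonneg (Eventually.of_forall fun ω => abs_nonneg _)
          (integrable_const _) hpt
    _ = 2 * η * (b - a) := by simp

/-- **Law of total covariance** for bounded measurable real `f, g` and a sub-σ-algebra `m ≤ m0` of
a probability space: `cov(f, g) = ∫ (E[fg|m] − E[f|m]·E[g|m]) dμ + cov(E[f|m], E[g|m])`. [folklore] -/
theorem covariance_eq_integral_condCov_add [IsProbabilityMeasure μ] (hm : m ≤ m0) {f g : Ω → ℝ}
    (hf : AEStronglyMeasurable f μ) (hg : AEStronglyMeasurable g μ) {Cf Cg : ℝ}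
    (hCf : ∀ᵐ ω ∂μ, |f ω| ≤ Cf) (hCg : ∀ᵐ ω ∂μ, |g ω| ≤ Cg) :
    cov[f, g; μ] =
      (∫ ω, ((μ[f * g|m]) ω - (μ[f|m]) ω * (μ[g|m]) ω) ∂μ) + cov[μ[f|m], μ[g|m]; μ] := by
  haveI : SigmaFinite (μ.trim hm) := inferInstance
  have hf2 : MemLp f 2 μ := memLp_two_of_ae_bound hf hCf
  have hg2 : MemLp g 2 μ := memLp_two_of_ae_bound hg hCg
  have hfg : Integrable (f * g) μ := hf2.integrable_mul hg2
  -- the conditional expectations are bounded a.e., hence in L²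
  have hFm : AEStronglyMeasurable (μ[f|m]) μ :=
    (stronglyMeasurable_condExp.mono hm).aestronglyMeasurable
  have hGm : AEStronglyMeasurable (μ[g|m]) μ :=
    (stronglyMeasurable_condExp.mono hm).aestronglyMeasurable
  have hFb : ∀ᵐ ω ∂μ, |(μ[f|m]) ω| ≤ Cf := ae_bdd_abs_condExp_of_ae_bdd_abs hCf
  have hGb : ∀ᵐ ω ∂μ, |(μ[g|m]) ω| ≤ Cg := ae_bdd_abs_condExp_of_ae_bdd_abs hCg
  have hF2 : MemLp (μ[f|m]) 2 μ := memLp_two_of_ae_bound hFm hFb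
  have hG2 : MemLp (μ[g|m]) 2 μ := memLp_two_of_ae_bound hGm hGb
  have hFG : Integrable (μ[f|m] * μ[g|m]) μ := hF2.integrable_mul hG2
  -- expand both covariances
  rw [covariance_eq_sub hf2 hg2, covariance_eq_sub hF2 hG2]
  have hsub : ∫ ω, ((μ[f * g|m]) ω - (μ[f|m]) ω * (μ[g|m]) ω) ∂μ =
      (∫ ω, (μ[f * g|m]) ω ∂μ) - ∫ ω, ((μ[f|m]) ω * (μ[g|m]) ω) ∂μ :=
    integral_sub integrable_condExp hFG
  rw [hsub, integral_condExp hm, integral_condExp hm, integral_condExp hm]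
  simp only [Pi.mul_apply]
  ring

end Summit.Ventures.YMGap.YM3IR

end
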